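import Mathlib
import Literature.Analysis.UnboundedOperators.HeatKernelBoundedData
import Literature.Analysis.UnboundedOperators.HeatKernelCommutator
import Literature.Analysis.UnboundedOperators.HeatExtensionDecay
import Literature.Analysis.UnboundedOperators.HeatIteratedDerivBounds

/-!
# Route `FilamentSkeletonRss` · crux `TransverseReduction1A` (stmt-27414; successor of the aside `TransverseReductionRJ`,
# stmt-21221) — line `kelvin_gate`: WEIGHT-`k` HEAT-KERNEL TOOLKIT, `1 ≤ k ≤ 2`

Helper file (theorems only, `--as helper`).  HONEST FRAMING: analysis bookkeeping for a HYPOTHETICAL filament-type rotating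
self-similar blow-up route; nothing here bears on Navier–Stokes regularity; no stub is proved here.

Why (design memo SHARP-WEIGHTS-DESIGN-21221-g7 §3, item m3): the free Kelvin gate in the sharp scales
`X♯_a = (⟨y⟩|W|, ⟨y⟩^a|DW|, ⟨y⟩^a|D²W|)`, `Y♯_a = (⟨y⟩^{a+1}|F|, ⟨y⟩^{a+1}|DF|)` (`1 < a < 2`, `⟨y⟩ = 1 + |y|`) runs the
Ornstein–Uhlenbeck resolvent on the PROJECTED datum `G = F − ∇Q`, which is only continuous with the weight `⟨x⟩^a` and an
`⟨x⟩^a`-weighted LOCAL Hölder modulus.  The weight-one toolkit (`…KelvinGateWeightedHolderGain`, `…Gain2`) is here redone at a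
real weight `k ∈ [1, 2]` in a finite-dimensional inner product space `E` (`n = dim E`, `c = 2^{n/2}`, `c′ = 1 + 2c`), values in a
real Banach space:

* `weight_rpow_mul_norm_comp_sub_le` — `(1+|x|)^k ‖f(x−y)‖ ≤ A (1+|y|)^k` (`1 + |x| ≤ (1+|x−y|)(1+|y|)`);
* `integral_heatKernel_mul_weight_rpow_le` — `∫ G_t(y)(1+|y|)^k dy ≤ 1 + 4c t^{1/2} + 8√2 c² t`;
* `weight_rpow_norm_heatExtension_le` — `(1+|x|)^k ‖e^{tΔ}f(x)‖ ≤ (1 + 4c t^{1/2} + 8√2 c² t) A`;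
* `weight_rpow_norm_fderiv_heatExtension_le` — `(1+|x|)^k ‖∇e^{tΔ}f(x)‖ ≤ c t^{-1/2}(1 + 4c(2t)^{1/2} + 16√2c²t) A` for continuous `f`;

The weighted LOCAL Hölder gains of the gradient and of the Hessian, and the packaged constant, are in the sequel
`…KelvinGateWeightKHeatHolder`.
-/

set_option linter.dupNamespace false

noncomputable section

namespace Summit.NavierStokesRegularity.NavierStokesRegularity.Theorems.KelvinGate

open Set Function Filter MeasureTheory Metric Real
open Literature.Analysis.UnboundedOperators
open scoped ENNReal Topology

section WeightK

variable {E : Type*} [NormedAddCommGroup E] [InnerProductSpace ℝ E] [FiniteDimensional ℝ E]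
  [MeasurableSpace E] [BorelSpace E]
variable {F : Type*} [NormedAddCommGroup F] [NormedSpace ℝ F] [CompleteSpace F]

/-! ## Elementary weight inequalities -/

/-- `(1+u)^k ≤ (1+u)^2` for `0 ≤ u` and `k ≤ 2` (the base is at least one). -/
theorem one_add_rpow_le_sq {u k : ℝ} (hu : 0 ≤ u) (hk2 : k ≤ 2) : (1 + u) ^ k ≤ (1 + u) ^ 2 := by
  have h1 : 1 ≤ 1 + u := by linarith
  calc (1 + u) ^ k ≤ (1 + u) ^ (2:ℝ) := Real.rpow_le_rpow_of_exponent_le h1 hk2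
    _ = (1 + u) ^ 2 := by norm_cast

omit [InnerProductSpace ℝ E] [FiniteDimensional ℝ E] [MeasurableSpace E] [BorelSpace E] [NormedSpace ℝ F]
  [CompleteSpace F] in
/-- The weight moves across a translation: `1 + |x| ≤ (1 + |x − y|)(1 + |y|)`, hence
`(1+|x|)^k ‖f(x − y)‖ ≤ A (1 + |y|)^k` when `(1+|z|)^k ‖f(z)‖ ≤ A` (`0 ≤ k`). -/
theorem weight_rpow_mul_norm_comp_sub_le {f : E → F} {A k : ℝ} (hk : 0 ≤ k)
    (hf : ∀ z, (1 + ‖z‖) ^ k * ‖f z‖ ≤ A) (x y : E) :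
    (1 + ‖x‖) ^ k * ‖f (x - y)‖ ≤ A * (1 + ‖y‖) ^ k := by
  have h1 : 1 + ‖x‖ ≤ (1 + ‖x - y‖) * (1 + ‖y‖) := by
    have : ‖x‖ ≤ ‖x - y‖ + ‖y‖ := by
      calc ‖x‖ = ‖(x - y) + y‖ := by rw [sub_add_cancel]
        _ ≤ ‖x - y‖ + ‖y‖ := norm_add_le _ _
    nlinarith [norm_nonneg (x - y), norm_nonneg y]
  have h2 : (1 + ‖x‖) ^ k ≤ (1 + ‖x - y‖) ^ k * (1 + ‖y‖) ^ k := by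
    rw [← Real.mul_rpow (by positivity) (by positivity)]
    exact Real.rpow_le_rpow (by positivity) h1 hk
  calc (1 + ‖x‖) ^ k * ‖f (x - y)‖ ≤ ((1 + ‖x - y‖) ^ k * (1 + ‖y‖) ^ k) * ‖f (x - y)‖ :=
        mul_le_mul_of_nonneg_right h2 (norm_nonneg _)
    _ = ((1 + ‖x - y‖) ^ k * ‖f (x - y)‖) * (1 + ‖y‖) ^ k := by ring
    _ ≤ A * (1 + ‖y‖) ^ k := mul_le_mul_of_nonneg_right (hf _) (by positivity)

omit [InnerProductSpace ℝ E] [FiniteDimensional ℝ E] [MeasurableSpace E] [BorelSpace E] [NormedSpace ℝ F]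
  [CompleteSpace F] in
/-- A weighted bound is a bound: `‖f z‖ ≤ A` when `(1+|z|)^k ‖f z‖ ≤ A`, `0 ≤ k`. -/
theorem norm_le_of_weight_rpow_mul_norm_le {f : E → F} {A k : ℝ} (hk : 0 ≤ k)
    (hf : ∀ z, (1 + ‖z‖) ^ k * ‖f z‖ ≤ A) (z : E) : ‖f z‖ ≤ A := by
  have h1 : 1 ≤ (1 + ‖z‖) ^ k := Real.one_le_rpow (by linarith [norm_nonneg z]) hk
  have := hf z
  nlinarith [norm_nonneg (f z)]

/-! ## Moments of the heat kernel against the weight `(1+|y|)^k` -/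

/-- `∫ G_t(y) ‖y‖² dy ≤ 4√2 · c² · t` (`c = 2^{n/2}`): twice the Gaussian bound `‖y‖ G_s(y) ≤ 2c s^{1/2} G_{2s}(y)`. -/
theorem integral_heatKernel_mul_norm_sq_le {t : ℝ} (ht : 0 < t) :
    Integrable (fun y : E => heatKernel t y * ‖y‖ ^ 2) ∧
    ∫ y : E, heatKernel t y * ‖y‖ ^ 2 ≤
      4 * (2 : ℝ) ^ (1 / 2 : ℝ) * ((2 : ℝ) ^ ((Module.finrank ℝ E : ℝ) / 2)) ^ 2 * t := by
  set c : ℝ := (2 : ℝ) ^ ((Module.finrank ℝ E : ℝ) / 2) with hc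
  have hc0 : 0 < c := Real.rpow_pos_of_pos two_pos _
  have h2t : 0 < 2 * t := by positivity
  have h4t : 0 < 4 * t := by positivity
  set K : ℝ := 2 * c * t ^ (1 / 2 : ℝ) * (2 * c * (2 * t) ^ (1 / 2 : ℝ)) with hK
  have hK0 : 0 ≤ K := by positivity
  have hKeq : K = 4 * (2 : ℝ) ^ (1 / 2 : ℝ) * c ^ 2 * t := by
    have h1 : t ^ (1 / 2 : ℝ) * (2 * t) ^ (1 / 2 : ℝ) = (2 : ℝ) ^ (1 / 2 : ℝ) * t := by
      rw [Real.mul_rpow zero_le_two ht.le, ← mul_assoc, mul_comm (t ^ (1 / 2 : ℝ)), mul_assoc, ← Real.rpow_add ht]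
      norm_num
    calc K = 4 * c ^ 2 * (t ^ (1 / 2 : ℝ) * (2 * t) ^ (1 / 2 : ℝ)) := by rw [hK]; ring
      _ = _ := by rw [h1]; ring
  have hpt : ∀ y : E, heatKernel t y * ‖y‖ ^ 2 ≤ K * heatKernel (4 * t) y := fun y => by
    have h1 := norm_mul_heatKernel_le ht y
    have h2 := norm_mul_heatKernel_le h2t y
    rw [show 2 * (2 * t) = 4 * t by ring] at h2
    calc heatKernel t y * ‖y‖ ^ 2 = ‖y‖ * (‖y‖ * heatKernel t y) := by ring
      _ ≤ ‖y‖ * (2 * c * t ^ (1 / 2 : ℝ) * heatKernel (2 * t) y) := mul_le_mul_of_nonneg_left h1 (norm_nonneg _)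
      _ = 2 * c * t ^ (1 / 2 : ℝ) * (‖y‖ * heatKernel (2 * t) y) := by ring
      _ ≤ 2 * c * t ^ (1 / 2 : ℝ) * (2 * c * (2 * t) ^ (1 / 2 : ℝ) * heatKernel (4 * t) y) :=
          mul_le_mul_of_nonneg_left h2 (by positivity)
      _ = K * heatKernel (4 * t) y := by rw [hK]; ring
  have hdom : Integrable (fun y : E => K * heatKernel (4 * t) y) := (integrable_heatKernel_holds h4t).const_mul K
  have hmeas : AEStronglyMeasurable (fun y : E => heatKernel t y * ‖y‖ ^ 2) volume :=
    ((continuous_heatKernel t).mul (continuous_norm.pow 2)).aestronglyMeasurable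
  have hint : Integrable (fun y : E => heatKernel t y * ‖y‖ ^ 2) :=
    hdom.mono' hmeas (Eventually.of_forall fun y => by
      rw [Real.norm_of_nonneg (mul_nonneg (heatKernel_pos ht y).le (sq_nonneg _))]; exact hpt y)
  refine ⟨hint, ?_⟩
  calc ∫ y : E, heatKernel t y * ‖y‖ ^ 2 ≤ ∫ y : E, K * heatKernel (4 * t) y := integral_mono hint hdom hpt
    _ = K := by rw [integral_const_mul, integral_heatKernel_eq_one_holds h4t, mul_one]
    _ = _ := hKeq

/-- **Weight moment of the heat kernel**: for `k ≤ 2`,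
`∫ G_t(y) (1+|y|)^k dy ≤ 1 + 4c t^{1/2} + 8√2 c² t` (`(1+u)^k ≤ 1 + 2u + u²`, mass one, first and second moments). -/
theorem integral_heatKernel_mul_weight_rpow_le {t : ℝ} (ht : 0 < t) {k : ℝ} (hk2 : k ≤ 2) :
    Integrable (fun y : E => heatKernel t y * (1 + ‖y‖) ^ k) ∧
    ∫ y : E, heatKernel t y * (1 + ‖y‖) ^ k ≤
      1 + 4 * (2 : ℝ) ^ ((Module.finrank ℝ E : ℝ) / 2) * t ^ (1 / 2 : ℝ) +
        8 * (2 : ℝ) ^ (1 / 2 : ℝ) * ((2 : ℝ) ^ ((Module.finrank ℝ E : ℝ) / 2)) ^ 2 * t := by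
  set c : ℝ := (2 : ℝ) ^ ((Module.finrank ℝ E : ℝ) / 2) with hc
  have hK := integrable_heatKernel_holds (E := E) ht
  have hM1 := integrable_heatKernel_mul_norm (E := E) ht
  obtain ⟨hM2, hM2le⟩ := integral_heatKernel_mul_norm_sq_le (E := E) ht
  have h12 : Integrable (fun y : E => heatKernel t y + 2 * (heatKernel t y * ‖y‖)) := hK.add (hM1.const_mul 2)
  have hdom : Integrable (fun y : E => heatKernel t y + 2 * (heatKernel t y * ‖y‖) + heatKernel t y * ‖y‖ ^ 2) :=
    h12.add hM2
  have hpt : ∀ y : E, heatKernel t y * (1 + ‖y‖) ^ k ≤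
      heatKernel t y + 2 * (heatKernel t y * ‖y‖) + heatKernel t y * ‖y‖ ^ 2 := fun y => by
    have h := one_add_rpow_le_sq (norm_nonneg y) hk2
    calc heatKernel t y * (1 + ‖y‖) ^ k ≤ heatKernel t y * (1 + ‖y‖) ^ 2 :=
          mul_le_mul_of_nonneg_left h (heatKernel_pos ht y).le
      _ = _ := by ring
  have hmeas : AEStronglyMeasurable (fun y : E => heatKernel t y * (1 + ‖y‖) ^ k) volume :=
    ((continuous_heatKernel t).mul ((continuous_const.add continuous_norm).rpow_const
      fun y => Or.inl (ne_of_gt (add_pos_of_pos_of_nonneg one_pos (norm_nonneg _))))).aestronglyMeasurable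
  have hint : Integrable (fun y : E => heatKernel t y * (1 + ‖y‖) ^ k) :=
    hdom.mono' hmeas (Eventually.of_forall fun y => by
      rw [Real.norm_of_nonneg (mul_nonneg (heatKernel_pos ht y).le (by positivity))]; exact hpt y)
  refine ⟨hint, ?_⟩
  calc ∫ y : E, heatKernel t y * (1 + ‖y‖) ^ k
      ≤ ∫ y : E, (heatKernel t y + 2 * (heatKernel t y * ‖y‖) + heatKernel t y * ‖y‖ ^ 2) :=
        integral_mono hint hdom hpt
    _ = 1 + 2 * (∫ y : E, heatKernel t y * ‖y‖) + ∫ y : E, heatKernel t y * ‖y‖ ^ 2 := by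
        rw [integral_add h12 hM2, integral_add hK (hM1.const_mul 2), integral_const_mul,
          integral_heatKernel_eq_one_holds ht]
    _ ≤ 1 + 2 * (2 * c * t ^ (1 / 2 : ℝ)) + 4 * (2 : ℝ) ^ (1 / 2 : ℝ) * c ^ 2 * t := by
        have h1 := integral_heatKernel_mul_norm_le (E := E) ht
        nlinarith
    _ ≤ _ := by
        have : 0 ≤ 4 * (2 : ℝ) ^ (1 / 2 : ℝ) * c ^ 2 * t := by positivity
        nlinarith

/-- **Weight moment of the gradient of the heat kernel**: for `k ≤ 2`,
`∫ ‖∇G_t(y)‖ (1+|y|)^k dy ≤ c t^{-1/2} (1 + 4c (2t)^{1/2} + 16√2 c² t)` (Gaussian bound `‖∇G_t‖ ≤ c t^{-1/2} G_{2t}`). -/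
theorem integral_norm_fderiv_heatKernel_mul_weight_rpow_le {t : ℝ} (ht : 0 < t) {k : ℝ} (hk2 : k ≤ 2) :
    Integrable (fun y : E => ‖fderiv ℝ (heatKernel t) y‖ * (1 + ‖y‖) ^ k) ∧
    ∫ y : E, ‖fderiv ℝ (heatKernel t) y‖ * (1 + ‖y‖) ^ k ≤
      (2 : ℝ) ^ ((Module.finrank ℝ E : ℝ) / 2) * t ^ (-(1 / 2 : ℝ)) *
        (1 + 4 * (2 : ℝ) ^ ((Module.finrank ℝ E : ℝ) / 2) * (2 * t) ^ (1 / 2 : ℝ) +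
          8 * (2 : ℝ) ^ (1 / 2 : ℝ) * ((2 : ℝ) ^ ((Module.finrank ℝ E : ℝ) / 2)) ^ 2 * (2 * t)) := by
  set c : ℝ := (2 : ℝ) ^ ((Module.finrank ℝ E : ℝ) / 2) with hc
  have h2t : 0 < 2 * t := by positivity
  obtain ⟨hI2, hI2le⟩ := integral_heatKernel_mul_weight_rpow_le (E := E) h2t hk2
  set a : ℝ := c * t ^ (-(1 / 2 : ℝ)) with ha
  have ha0 : 0 ≤ a := by positivity
  have hpt : ∀ y : E, ‖fderiv ℝ (heatKernel t) y‖ * (1 + ‖y‖) ^ k ≤ a * (heatKernel (2 * t) y * (1 + ‖y‖) ^ k) :=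
    fun y => by
    have h := norm_fderiv_heatKernel_le_heatKernel_two_mul ht y
    calc ‖fderiv ℝ (heatKernel t) y‖ * (1 + ‖y‖) ^ k ≤ (a * heatKernel (2 * t) y) * (1 + ‖y‖) ^ k :=
          mul_le_mul_of_nonneg_right h (by positivity)
      _ = _ := by ring
  have hdom : Integrable (fun y : E => a * (heatKernel (2 * t) y * (1 + ‖y‖) ^ k)) := hI2.const_mul a
  have hmeas : AEStronglyMeasurable (fun y : E => ‖fderiv ℝ (heatKernel t) y‖ * (1 + ‖y‖) ^ k) volume :=
    ((continuous_fderiv_heatKernel t).norm.mul ((continuous_const.add continuous_norm).rpow_const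
      fun y => Or.inl (ne_of_gt (add_pos_of_pos_of_nonneg one_pos (norm_nonneg _))))).aestronglyMeasurable
  have hint : Integrable (fun y : E => ‖fderiv ℝ (heatKernel t) y‖ * (1 + ‖y‖) ^ k) :=
    hdom.mono' hmeas (Eventually.of_forall fun y => by
      rw [Real.norm_of_nonneg (mul_nonneg (norm_nonneg _) (by positivity))]; exact hpt y)
  refine ⟨hint, ?_⟩
  calc ∫ y : E, ‖fderiv ℝ (heatKernel t) y‖ * (1 + ‖y‖) ^ k
      ≤ ∫ y : E, a * (heatKernel (2 * t) y * (1 + ‖y‖) ^ k) := integral_mono hint hdom hpt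
    _ = a * ∫ y : E, heatKernel (2 * t) y * (1 + ‖y‖) ^ k := integral_const_mul _ _
    _ ≤ a * (1 + 4 * c * (2 * t) ^ (1 / 2 : ℝ) + 8 * (2 : ℝ) ^ (1 / 2 : ℝ) * c ^ 2 * (2 * t)) :=
        mul_le_mul_of_nonneg_left hI2le ha0

/-! ## The caloric extension and its gradient keep the weight `(1+|x|)^k` -/

omit [CompleteSpace F] in
/-- **Weight-`k` smoothing** (`0 ≤ k ≤ 2`): `(1+|x|)^k ‖e^{tΔ}f(x)‖ ≤ (1 + 4c t^{1/2} + 8√2 c² t) A` if `(1+|y|)^k ‖f‖ ≤ A`. -/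
theorem weight_rpow_norm_heatExtension_le {f : E → F} {A k : ℝ} (hk0 : 0 ≤ k) (hk2 : k ≤ 2)
    (hf : ∀ z, (1 + ‖z‖) ^ k * ‖f z‖ ≤ A) {t : ℝ} (ht : 0 < t) (x : E) :
    (1 + ‖x‖) ^ k * ‖heatExtension f t x‖ ≤
      (1 + 4 * (2 : ℝ) ^ ((Module.finrank ℝ E : ℝ) / 2) * t ^ (1 / 2 : ℝ) +
        8 * (2 : ℝ) ^ (1 / 2 : ℝ) * ((2 : ℝ) ^ ((Module.finrank ℝ E : ℝ) / 2)) ^ 2 * t) * A := by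
  have hA : 0 ≤ A := le_trans (by positivity) (hf 0)
  obtain ⟨hI, hIle⟩ := integral_heatKernel_mul_weight_rpow_le (E := E) ht hk2
  have hx : 0 < (1 + ‖x‖) ^ k := by positivity
  rw [heatExtension_apply]
  have hb : ∀ y, ‖heatKernel t y • f (x - y)‖ ≤ ((1 + ‖x‖) ^ k)⁻¹ * (A * (heatKernel t y * (1 + ‖y‖) ^ k)) := by
    intro y
    rw [norm_smul, Real.norm_of_nonneg (heatKernel_pos ht y).le, le_inv_mul_iff₀ hx]
    calc (1 + ‖x‖) ^ k * (heatKernel t y * ‖f (x - y)‖) = heatKernel t y * ((1 + ‖x‖) ^ k * ‖f (x - y)‖) := by ring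
      _ ≤ heatKernel t y * (A * (1 + ‖y‖) ^ k) :=
          mul_le_mul_of_nonneg_left (weight_rpow_mul_norm_comp_sub_le hk0 hf x y) (heatKernel_pos ht y).le
      _ = A * (heatKernel t y * (1 + ‖y‖) ^ k) := by ring
  have hbI : Integrable (fun y : E => ((1 + ‖x‖) ^ k)⁻¹ * (A * (heatKernel t y * (1 + ‖y‖) ^ k))) :=
    (hI.const_mul A).const_mul _
  calc (1 + ‖x‖) ^ k * ‖∫ y, heatKernel t y • f (x - y)‖
      ≤ (1 + ‖x‖) ^ k * ∫ y, ((1 + ‖x‖) ^ k)⁻¹ * (A * (heatKernel t y * (1 + ‖y‖) ^ k)) :=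
        mul_le_mul_of_nonneg_left (norm_integral_le_of_norm_le hbI (Eventually.of_forall hb)) hx.le
    _ = A * ∫ y : E, heatKernel t y * (1 + ‖y‖) ^ k := by
        rw [integral_const_mul, integral_const_mul, ← mul_assoc, mul_inv_cancel₀ hx.ne', one_mul]
    _ ≤ _ := by rw [mul_comm]; exact mul_le_mul_of_nonneg_right hIle hA

/-- **Weight-`k` gradient bound for continuous weighted data** (`0 ≤ k ≤ 2`):
`(1+|x|)^k ‖∇e^{tΔ}f(x)‖ ≤ c t^{-1/2} (1 + 4c (2t)^{1/2} + 16√2 c² t) A` for continuous `f` with `(1+|y|)^k ‖f‖ ≤ A`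
(`‖∇e^{tΔ}f(x)‖ ≤ ∫ ‖∇G_t(y)‖ ‖f(x−y)‖ dy`). -/
theorem weight_rpow_norm_fderiv_heatExtension_le {f : E → F} (hfc : Continuous f) {A k : ℝ} (hk0 : 0 ≤ k)
    (hk2 : k ≤ 2) (hf : ∀ z, (1 + ‖z‖) ^ k * ‖f z‖ ≤ A) {t : ℝ} (ht : 0 < t) (x : E) :
    (1 + ‖x‖) ^ k * ‖fderiv ℝ (heatExtension f t) x‖ ≤
      (2 : ℝ) ^ ((Module.finrank ℝ E : ℝ) / 2) * t ^ (-(1 / 2 : ℝ)) *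
        (1 + 4 * (2 : ℝ) ^ ((Module.finrank ℝ E : ℝ) / 2) * (2 * t) ^ (1 / 2 : ℝ) +
          8 * (2 : ℝ) ^ (1 / 2 : ℝ) * ((2 : ℝ) ^ ((Module.finrank ℝ E : ℝ) / 2)) ^ 2 * (2 * t)) * A := by
  have hA : 0 ≤ A := le_trans (by positivity) (hf 0)
  have hC : ∀ z, ‖f z‖ ≤ A := norm_le_of_weight_rpow_mul_norm_le hk0 hf
  have hmem : MemLp f ∞ (volume : Measure E) := memLp_top_of_continuous_of_bound hfc hC
  have h1 := norm_fderiv_heatExtension_le hmem le_top ht x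
  rw [MeasureTheory.convolution_def] at h1
  simp only [ContinuousLinearMap.lsmul_apply, smul_eq_mul] at h1
  obtain ⟨hI, hIle⟩ := integral_norm_fderiv_heatKernel_mul_weight_rpow_le (E := E) ht hk2
  have hx : 0 < (1 + ‖x‖) ^ k := by positivity
  have hb : ∀ y, ‖fderiv ℝ (heatKernel t) y‖ * ‖f (x - y)‖ ≤
      ((1 + ‖x‖) ^ k)⁻¹ * (A * (‖fderiv ℝ (heatKernel t) y‖ * (1 + ‖y‖) ^ k)) := by
    intro y
    rw [le_inv_mul_iff₀ hx]
    calc (1 + ‖x‖) ^ k * (‖fderiv ℝ (heatKernel t) y‖ * ‖f (x - y)‖)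
        = ‖fderiv ℝ (heatKernel t) y‖ * ((1 + ‖x‖) ^ k * ‖f (x - y)‖) := by ring
      _ ≤ ‖fderiv ℝ (heatKernel t) y‖ * (A * (1 + ‖y‖) ^ k) :=
          mul_le_mul_of_nonneg_left (weight_rpow_mul_norm_comp_sub_le hk0 hf x y) (norm_nonneg _)
      _ = _ := by ring
  have hbI : Integrable (fun y : E => ((1 + ‖x‖) ^ k)⁻¹ * (A * (‖fderiv ℝ (heatKernel t) y‖ * (1 + ‖y‖) ^ k))) :=
    (hI.const_mul A).const_mul _
  have hlhsI : Integrable (fun y : E => ‖fderiv ℝ (heatKernel t) y‖ * ‖f (x - y)‖) :=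
    hbI.mono' ((continuous_fderiv_heatKernel t).norm.mul (hfc.comp (continuous_const.sub continuous_id)).norm).aestronglyMeasurable
      (Eventually.of_forall fun y => by
        rw [Real.norm_of_nonneg (mul_nonneg (norm_nonneg _) (norm_nonneg _))]; exact hb y)
  calc (1 + ‖x‖) ^ k * ‖fderiv ℝ (heatExtension f t) x‖
      ≤ (1 + ‖x‖) ^ k * ∫ y, ‖fderiv ℝ (heatKernel t) y‖ * ‖f (x - y)‖ := mul_le_mul_of_nonneg_left h1 hx.le
    _ ≤ (1 + ‖x‖) ^ k * ∫ y, ((1 + ‖x‖) ^ k)⁻¹ * (A * (‖fderiv ℝ (heatKernel t) y‖ * (1 + ‖y‖) ^ k)) :=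
        mul_le_mul_of_nonneg_left (integral_mono hlhsI hbI hb) hx.le
    _ = A * ∫ y : E, ‖fderiv ℝ (heatKernel t) y‖ * (1 + ‖y‖) ^ k := by
        rw [integral_const_mul, integral_const_mul, ← mul_assoc, mul_inv_cancel₀ hx.ne', one_mul]
    _ ≤ _ := by rw [mul_comm]; exact mul_le_mul_of_nonneg_right hIle hA


end WeightK

end Summit.NavierStokesRegularity.NavierStokesRegularity.Theorems.KelvinGate

end
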